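import Literature.Combinatorics.Optimization.ShellLawLineSection
import Literature.Combinatorics.Optimization.ShellLawWindowLowerBoundAFree
import Literature.Combinatorics.Optimization.ShellLawRelativeLevelSmoothness
import HarnessLib

/-!
# The two level-`1` floors of the shell law on a WINDOW SET of the block statistic

Cell pnp-psdrank (literature seat g39). The Summits-side γ-direction bricks (141 `…CentredDischarge`, 142
`…GammaDirectionDischarged`, 143 the exp form) quantify their two Literature inputs over a window set
`B ⊆ ℤ` of values `y` of the block statistic `|U ∩ H|`, in the currency
`|y − (2s+1)·|H|/n| < ε` (the ambient `n = |Fin n|`, the block `H`, the cut `2s+1`):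
* `hV  : ∀ y ∈ B, ∀ m, cV · law_{univ}(2s+1,1;y) ≤ A^m_1(y)` — the variance floor (V) of the `HH` count given the
  block statistic (`ShellLawLineSection.centredSq_law_ge_of_scale`, `cV = (β/32)²·P⁸` for `N₀ = P⁸`);
* `hLBl : ∀ y ∈ B, LB ≤ law_{univ}(2s+1,1;y)` — the `a`-free window floor
  (`ShellLawWindowLowerBoundAFree.shellLaw_one_window_lower_afree_cell`, `LB = e^{−64(ε+11)²/(β⁵N₀)}/(128N₀²)`).
This leaf file states both IN THAT CURRENCY (`centredSq_law_ge_on_windowSet`, `shellLaw_window_lower_on_windowSet`):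
the point `y : ℤ` with `0 ≤ y`, the window against `|H|/n`, converted once (`window_of_cardForm`: on the ground set
of a perfect matching `|H| = 2a + b` and `n = 2N₀` for the `H`-type `(a, b, d)`, `a + b + d = N₀` —
`ShellLawRelativeLevelSmoothness.card_eq_two_mul_add_of_types`, `ShellLawGeneratingPolynomial.two_mul_typeReps_eq_card`).
All PROVED; no definitions, no named facts. Constants asymptotic-only, as everything on this line.

## References
* [Rothvoss2017] T. Rothvoß, *The matching polytope has exponential extension complexity*, J. ACM 64 (2017), §2
  (PDF pp. 5–6): cuts, perfect matchings, the three edge types of a block.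
* [ChattamvelliShanmugam2020] R. Chattamvelli, R. Shanmugam, *Discrete Distributions in Engineering and the Applied
  Sciences* (2020), §7.4 (PDF p. 144): the multivariate hypergeometric law (the conditional law behind (V)).
* [RollinRoss2010] A. Röllin, N. Ross, *Local limit theorems via Landau–Kolmogorov inequalities*, §4.1 Thm 4.2
  (the variance scale of the window floor).
-/

noncomputable section

open Finset

namespace Literature.Combinatorics.Optimization

namespace ShellStep

variable {n : ℕ} {π : Fin n → Fin n} (hπ : ∀ v, π (π v) = v) (hπ' : ∀ v, π v ≠ v)
include hπ hπ'

/-- **Window conversion.** On the ground set `univ` of a fixed-point-free involution on `Fin n`, a block `H` of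
type `(a, b, d)` with `a + b + d = N₀` has `|H| = 2a + b` and `n = 2N₀`; hence the Summits-side window
`|y − (2s+1)|H|/n| < ε` at an integer point `y = x` is the Literature window `|x − (2s+1)(2a+b)/(2N₀)| ≤ ε`.
[cite: Rothvoss2017, §2 (PDF p. 5)] -/
theorem window_of_cardForm (H : Finset (Fin n)) {a b d N₀ : ℕ}
    (ha : (reps π (vAA π univ H)).card = a) (hb : (reps π (vBH π univ H ∪ vBN π univ H)).card = b)
    (hd : (reps π (vDD π univ H)).card = d) (hN : a + b + d = N₀) {s x : ℕ} {ε : ℝ}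
    (hwin : |((x : ℤ) : ℝ) - (2 * (s : ℝ) + 1) * H.card / n| < ε) :
    |(x : ℝ) - (2 * s + 1) * (2 * a + b) / (2 * (N₀ : ℝ))| ≤ ε := by
  have hst : ∀ v ∈ (univ : Finset (Fin n)), π v ∈ (univ : Finset (Fin n)) := fun v _ => mem_univ _
  have hH : H.card = 2 * a + b := by rw [card_eq_two_mul_add_of_types hπ hπ' H, ha, hb]
  have hn : n = 2 * N₀ := by
    have h := two_mul_typeReps_eq_card hπ hπ' hst H
    rw [ha, hb, hd, card_univ, Fintype.card_fin] at h; omega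
  have hHr : (H.card : ℝ) = 2 * a + b := by rw [hH]; push_cast; ring
  have hnr : (n : ℝ) = 2 * (N₀ : ℝ) := by rw [hn]; push_cast; ring
  rw [hHr, hnr, Int.cast_natCast] at hwin
  have e : (2 * (s : ℝ) + 1) * (2 * a + b) / (2 * (N₀ : ℝ)) = (2 * s + 1) * (2 * a + b) / (2 * (N₀ : ℝ)) := by ring
  rw [e] at hwin
  exact hwin.le

/-- **(V) ON A WINDOW SET, in the Summits-side currency.** For a fixed-point-free involution `π` on `Fin n`, a
block `H` of type `(a, b, d)`, `a + b + d = N₀`, `0 < β ≤ 1/4`, `βN₀+1 ≤ a, b, d`, `βN₀ ≤ s`, `8s ≤ (4+β)N₀`, the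
scale `N₀ = P⁸` with the smallness condition `256(√2(β/32)P⁴ + 2)² + 3ε + 3 ≤ β²P⁸`
(`ShellLawLineSection.typeMargins_smallness_of_scale`), and ANY set `B` of integers `y ≥ 0` inside the window
`|y − (2s+1)|H|/n| < ε`: for every `y ∈ B` and every real `m`,
`((β/32)²·P⁸) · law_{univ}(2s+1,1;y) ≤ (Σ_{U ∈ Shell(2s+1,1), |U∩H| = y} (n_A(U) − m)²)/|Shell(2s+1,1)|` —
literally the hypothesis `hV` of bricks 141/142 with `cV = (β/32)²·P⁸`.
[cite: Rothvoss2017, §2 (PDF p. 6)] [cite: ChattamvelliShanmugam2020, §7.4 (PDF p. 144)] -/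
theorem centredSq_law_ge_on_windowSet (H : Finset (Fin n)) {a b d N₀ : ℕ}
    (ha : (reps π (vAA π univ H)).card = a) (hb : (reps π (vBH π univ H ∪ vBN π univ H)).card = b)
    (hd : (reps π (vDD π univ H)).card = d) (hN : a + b + d = N₀)
    {β : ℝ} (hβ : 0 < β) (hβ4 : β ≤ 1 / 4)
    (haβ : β * N₀ + 1 ≤ a) (hbβ : β * N₀ + 1 ≤ b) (hdβ : β * N₀ + 1 ≤ d)
    {s : ℕ} (hs : β * N₀ ≤ s) (hs' : 8 * (s : ℝ) ≤ (4 + β) * N₀)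
    {ε P : ℝ} (hN₀ : (N₀ : ℝ) = P ^ 8)
    (hsmall : 256 * (Real.sqrt 2 * (β / 32) * P ^ 4 + 2) ^ 2 + 3 * ε + 3 ≤ β ^ 2 * P ^ 8)
    (B : Finset ℤ) (hB : ∀ y ∈ B, 0 ≤ y ∧ |(y : ℝ) - (2 * (s : ℝ) + 1) * H.card / n| < ε) :
    ∀ y ∈ B, ∀ m : ℝ, ((β / 32) ^ 2 * P ^ 8) * shellLaw π univ H (2 * s + 1) 1 y ≤
      (∑ U ∈ (shell π (2 * s + 1) 1).filter (fun U => ((U ∩ H).card : ℤ) = y),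
          (((((reps π (vAA π univ H)).filter fun v => v ∈ U ∧ π v ∈ U).card : ℕ) : ℝ) - m) ^ 2) /
        ((shell π (2 * s + 1) 1).card : ℝ) := by
  intro y hy m
  obtain ⟨hy0, hwin⟩ := hB y hy
  obtain ⟨x, rfl⟩ := Int.eq_ofNat_of_zero_le hy0
  have hx := window_of_cardForm hπ hπ' H ha hb hd hN hwin
  exact centredSq_law_ge_of_scale hπ hπ' H ha hb hd hN hβ hβ4 haβ hbβ hdβ hs hs' hx hN₀ hsmall m

/-- **THE WINDOW FLOOR ON A WINDOW SET, in the Summits-side currency.** Same data without the `HH` margin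
(`βN₀+1 ≤ b, d` only) and the smallness condition `4ε + 36 ≤ β³N₀`: for every `y ∈ B`,
`e^{−64(ε+11)²/(β⁵N₀)}/(128N₀²) ≤ law_{univ}(2s+1,1;y)` — literally the hypothesis `hLBl` of bricks 141/142
with ONE `LB` for the whole window set (`ShellLawWindowLowerBoundAFree.shellLaw_one_window_lower_afree_cell`).
[cite: RollinRoss2010, §4.1 Thm 4.2] [cite: Rothvoss2017, §2 (PDF p. 6)] -/
theorem shellLaw_window_lower_on_windowSet (H : Finset (Fin n)) {a b d N₀ : ℕ}
    (ha : (reps π (vAA π univ H)).card = a) (hb : (reps π (vBH π univ H ∪ vBN π univ H)).card = b)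
    (hd : (reps π (vDD π univ H)).card = d) (hN : a + b + d = N₀)
    {β : ℝ} (hβ : 0 < β) (hβ4 : β ≤ 1 / 4) (hbβ : β * N₀ + 1 ≤ b) (hdβ : β * N₀ + 1 ≤ d)
    {s : ℕ} (hs : β * N₀ ≤ s) (hs' : 8 * (s : ℝ) ≤ (4 + β) * N₀)
    {ε : ℝ} (hε : 4 * ε + 36 ≤ β ^ 3 * N₀)
    (B : Finset ℤ) (hB : ∀ y ∈ B, 0 ≤ y ∧ |(y : ℝ) - (2 * (s : ℝ) + 1) * H.card / n| < ε) :
    ∀ y ∈ B, Real.exp (-(64 * (ε + 11) ^ 2 / (β ^ 5 * (N₀ : ℝ)))) / (128 * (N₀ : ℝ) ^ 2) ≤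
      shellLaw π univ H (2 * s + 1) 1 y := by
  intro y hy
  obtain ⟨hy0, hwin⟩ := hB y hy
  obtain ⟨x, rfl⟩ := Int.eq_ofNat_of_zero_le hy0
  have hst : ∀ v ∈ (univ : Finset (Fin n)), π v ∈ (univ : Finset (Fin n)) := fun v _ => mem_univ _
  have hx := window_of_cardForm hπ hπ' H ha hb hd hN hwin
  exact shellLaw_one_window_lower_afree_cell hπ hπ' hst H ha hb hd hN hβ hβ4 hbβ hdβ hs hs' hx hε

end ShellStep

end Literature.Combinatorics.Optimization

end
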